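import Literature.NumberTheory.EllipticCurves.WeberGamma3LevelFour
import Literature.NumberTheory.EllipticCurves.ModularCurveCoordinateRationality
import HarnessLib

/-!
# `γ₃(2τ) ∈ ℚ(X₀(4))`: the `q`-series of Weber's `γ₃(2τ)` is fixed by every endomorphism of `ℂ`

Topic `NumberTheory/EllipticCurves`, namespace `Literature.NumberTheory.EllipticCurves.ModularForms`.
Theorem-only file (no definition, no named fact); companion of `WeberGamma2LevelNineRational.lean`.
For `weberFourFn = γ₃(2τ) = E₆(2τ)η(2τ)¹²/Δ(2τ) ∈ K_4 ⊂ ℂ((q))` and every ring endomorphism `σ`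
of `ℂ` acting coefficientwise (`mapLaurent σ`):

* `mapLaurent_weberFourFn` — **`σ` fixes the `q`-series of `γ₃(2τ)`** (classically: `γ₃(τ)` has the
  rational `q`-expansion `q^{−1/2}(1 − 492q − …)`, Cox §12.B).

Proof.  (1) `σ` fixes the `q`-series of `j(2τ) − 1728 = (E₄(2τ)³ − 1728Δ(2τ))/Δ(2τ)`
(`mapLaurent_kleinJSubFn`).  (2) Hence `σ(γ₃(2τ))² = γ₃(2τ)²`, so `σ(γ₃(2τ)) = ±γ₃(2τ)` in the field
`ℂ((q))`.  (3) The sign is `+` by one rational coefficient: `γ₃(2τ)·Δ(2τ) = E₆(2τ)η(2τ)¹²` has first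
`q`-coefficient `1` (`qExpansion_weberFourNum_coeff_one`), from `E₆(2τ) = 1 + O(q²)` and
**`η(2τ)¹² = q + O(q²)`** (`qExpansion_etaDuodecicFour_coeff_one`, from the product
`η(2z)¹² = q∏(1 − q^{2(n+1)})¹²`).

## References

* D. A. Cox, *Primes of the form x² + ny²*, 2nd ed., 2013, §12.B (Weber's `γ₃`, Thm. 12.17).
  [Cox2013]
* F. Diamond, J. Shurman, *A First Course in Modular Forms*, GTM 228, 2005, §1.2. [DiamondShurman2005]
-/

noncomputable section

open UpperHalfPlane hiding I
open Complex ModularForm CongruenceSubgroup EisensteinSeries PowerSeries Filter Topology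
open scoped MatrixGroups Real ModularForm Manifold

namespace Literature.NumberTheory.EllipticCurves.ModularForms

/-! ### The `q`-expansion of `η(2τ)¹²` starts `q + O(q²)` -/

/-- **`η(2z)¹² = q ∏ (1 − q^{2(n+1)})¹²`**, `q = e^{2πiz}`. [folklore] -/
theorem etaDuodecicFour_eq_q_prod (z : ℍ) :
    etaDuodecicFour z = Function.Periodic.qParam 1 z * ∏' n : ℕ, (1 - (Function.Periodic.qParam 1 z) ^ (2 * (n + 1))) ^ 12 := by
  have hz2 : (2 * (z : ℂ)) ∈ upperHalfPlaneSet := by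
    simpa using mul_pos (by norm_num : (0 : ℝ) < 2) z.2
  have hq24 : (Function.Periodic.qParam 24 (2 * (z : ℂ))) ^ 12 = Function.Periodic.qParam 1 z := by
    simp only [Function.Periodic.qParam]
    rw [← Complex.exp_nat_mul]
    congr 1
    push_cast
    ring
  have hq1 : ∀ n : ℕ, eta_q n (2 * (z : ℂ)) = (Function.Periodic.qParam 1 z) ^ (2 * (n + 1)) := by
    intro n
    simp only [eta_q, Function.Periodic.qParam]
    rw [← Complex.exp_nat_mul, ← Complex.exp_nat_mul]
    congr 1
    push_cast
    ring
  have hmult : Multipliable fun n : ℕ ↦ 1 - eta_q n (2 * (z : ℂ)) :=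
    multipliableLocallyUniformlyOn_eta.multipliable hz2
  rw [etaDuodecicFour_apply, ModularForm.eta, mul_pow, hq24, ← Multipliable.tprod_pow hmult]
  congr 1
  exact tprod_congr fun n ↦ by rw [hq1]

/-- `η(2τ)¹² → 0` at `i∞`. [folklore] -/
theorem isZeroAtImInfty_etaDuodecicFour : IsZeroAtImInfty etaDuodecicFour := by
  have h := isZeroAtImInfty_etaDuodecicFour_slash 1
  simpa using h

/-- The cusp function of `η(2τ)¹²` on the unit disc is `q ∏ (1 − q^{2(i+1)})¹²`. [folklore] -/
theorem etaDuodecicFour_cuspFunction_eqOn : Set.EqOn (cuspFunction 1 etaDuodecicFour)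
    (fun q ↦ q * ∏' i : ℕ, (1 - q ^ (2 * (i + 1))) ^ 12) (Metric.ball 0 1) := by
  intro q hq
  by_cases hq0 : q = 0
  · simpa [hq0] using! Function.Periodic.cuspFunction_zero_of_zero_at_inf one_pos
      isZeroAtImInfty_etaDuodecicFour.zero_at_infty_comp_ofComplex
  · have him := Function.Periodic.im_invQParam_pos_of_norm_lt_one one_pos
      (by simpa [dist_zero_right] using hq) hq0
    simp [cuspFunction, Function.Periodic.cuspFunction_eq_of_nonzero 1 _ hq0,
      ofComplex_apply_of_im_pos him, etaDuodecicFour_eq_q_prod ⟨_, him⟩,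
      Function.Periodic.qParam_right_inv one_ne_zero hq0]

/-- The product factor is differentiable on the unit disc. [folklore] -/
theorem differentiableOn_tprod_one_sub_pow_two_mul :
    DifferentiableOn ℂ (fun q : ℂ ↦ ∏' i : ℕ, (1 - q ^ (2 * (i + 1))) ^ 12) (Metric.ball 0 1) := by
  have h := differentiableOn_tprod_one_sub_pow_pow 12
  have hcomp : (fun q : ℂ ↦ ∏' i : ℕ, (1 - q ^ (2 * (i + 1))) ^ 12) =
      (fun q : ℂ ↦ ∏' i : ℕ, (1 - q ^ (i + 1)) ^ 12) ∘ (fun q : ℂ ↦ q ^ 2) := by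
    funext q
    simp only [Function.comp_apply, ← pow_mul]
  rw [hcomp]
  refine h.comp (differentiableOn_pow 2) fun q hq ↦ ?_
  simp only [Metric.mem_ball, dist_zero_right, norm_pow] at hq ⊢
  calc ‖q‖ ^ 2 < 1 ^ 2 := by gcongr
    _ = 1 := one_pow 2

/-- **The first `q`-coefficient of `η(2τ)¹²` is `1`** (`η(2τ)¹² = q − 12q³ + …`). [folklore] -/
theorem qExpansion_etaDuodecicFour_coeff_one : (qExpansion 1 etaDuodecicFour).coeff 1 = 1 := by
  have hmem : (0 : ℂ) ∈ Metric.ball (0 : ℂ) 1 := Metric.mem_ball_self one_pos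
  calc (qExpansion 1 etaDuodecicFour).coeff 1
      = derivWithin (cuspFunction 1 etaDuodecicFour) (Metric.ball 0 1) 0 := by
        simp [qExpansion_coeff, ← derivWithin_of_isOpen Metric.isOpen_ball hmem]
    _ = derivWithin (fun q ↦ q * ∏' i : ℕ, (1 - q ^ (2 * (i + 1))) ^ 12) (Metric.ball 0 1) 0 :=
        derivWithin_congr etaDuodecicFour_cuspFunction_eqOn (etaDuodecicFour_cuspFunction_eqOn hmem)
    _ = 1 := by
        rw [derivWithin_fun_mul differentiableWithinAt_fun_id
            (differentiableOn_tprod_one_sub_pow_two_mul _ hmem),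
          derivWithin_id' _ _ (Metric.isOpen_ball.uniqueDiffWithinAt hmem)]
        simp

/-- **The constant `q`-coefficient of `η(2τ)¹²` is `0`.** [folklore] -/
theorem qExpansion_etaDuodecicFour_coeff_zero : (qExpansion 1 etaDuodecicFour).coeff 0 = 0 := by
  have hmem : (0 : ℂ) ∈ Metric.ball (0 : ℂ) 1 := Metric.mem_ball_self one_pos
  rw [qExpansion_coeff]
  simp only [Nat.factorial_zero, Nat.cast_one, inv_one, iteratedDeriv_zero, one_mul]
  rw [etaDuodecicFour_cuspFunction_eqOn hmem]
  simp

/-! ### The first coefficient of `E₆(2τ)η(2τ)¹²` is `1` -/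

/-- Power-series algebra: `a₀(e) = 1`, `a₀(h) = 0`, `a₁(h) = 1` give `a₁(e·h) = 1`. [folklore] -/
theorem coeff_one_mul_eq_one {e h : ℂ⟦X⟧} (he : coeff 0 e = 1) (h0 : coeff 0 h = 0)
    (h1 : coeff 1 h = 1) : coeff 1 (e * h) = 1 := by
  obtain ⟨r, hr⟩ : X ∣ h := PowerSeries.X_dvd_iff.mpr (by simpa using h0)
  have hr0 : coeff 0 r = 1 := by
    have := h1
    rw [hr, show (1 : ℕ) = 0 + 1 from rfl, PowerSeries.coeff_succ_X_mul] at this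
    exact this
  have hprod : e * h = X ^ 1 * (e * r) := by rw [hr]; ring
  rw [hprod, show (1 : ℕ) = 0 + 1 from rfl, PowerSeries.coeff_X_pow_mul]
  simp only [PowerSeries.coeff_zero_eq_constantCoeff, map_mul] at he hr0 ⊢
  rw [he, hr0]; ring

/-- `E₆(2τ)` has constant `q`-coefficient `1`. [folklore] -/
theorem qExpansion_E₆TwoFour_coeff_zero : (qExpansion 1 ⇑E₆TwoFour).coeff 0 = 1 := by
  change (qExpansion 1 ⇑(scaleN 2 ModularForm.E₆)).coeff 0 = 1
  rw [coeff_qExpansion_scaleN]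
  simp only [dvd_zero, ↓reduceIte, Nat.zero_div]
  exact EisensteinSeries.E_qExpansion_coeff_zero (by norm_num) (by decide)

/-- The underlying function of `etaDuodecicFourForm` is `etaDuodecicFour`. [folklore] -/
theorem coe_etaDuodecicFourForm : (⇑etaDuodecicFourForm : ℍ → ℂ) = etaDuodecicFour := rfl

/-- **`E₆(2τ)η(2τ)¹² = q + O(q²)`: the first `q`-coefficient of `weberFourNum` is `1`.** [folklore] -/
theorem qExpansion_weberFourNum_coeff_one : (qExpansion 1 ⇑weberFourNum).coeff 1 = 1 := by
  have hE := ModularFormClass.analyticAt_cuspFunction_zero E₆TwoFour one_pos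
    (one_mem_strictPeriods_coe_gamma0 4)
  have hη := ModularFormClass.analyticAt_cuspFunction_zero etaDuodecicFourForm one_pos
    (one_mem_strictPeriods_coe_gamma0 4)
  rw [coe_weberFourNum, UpperHalfPlane.qExpansion_mul hE hη]
  exact coeff_one_mul_eq_one qExpansion_E₆TwoFour_coeff_zero
    (by rw [coe_etaDuodecicFourForm]; exact qExpansion_etaDuodecicFour_coeff_zero)
    (by rw [coe_etaDuodecicFourForm]; exact qExpansion_etaDuodecicFour_coeff_one)

/-! ### `σ` fixes the `q`-series of `j(2τ) − 1728` and of `γ₃(2τ)` -/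

variable (σ : ℂ →+* ℂ)

/-- `E₄(2τ)` has a `σ`-fixed `q`-expansion. [folklore] -/
theorem isRatQExp_E₄TwoFour : IsRatQExp σ ⇑E₄TwoFour :=
  isRatQExp_scaleN_E₄ (N := 2) σ

/-- `Δ(2τ)` has a `σ`-fixed `q`-expansion. [folklore] -/
theorem isRatQExp_deltaTwoFour : IsRatQExp σ ⇑deltaTwoFour :=
  isRatQExp_scaleN (N := 2) σ delta (isRatQExp_discriminant σ).map_eq

/-- `E₄(2τ)³` has a `σ`-fixed `q`-expansion. [folklore] -/
theorem isRatQExp_E₄TwoFourCube : IsRatQExp σ ⇑E₄TwoFourCube := by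
  rw [coe_E₄TwoFourCube]
  exact ((isRatQExp_E₄TwoFour σ).mul (isRatQExp_E₄TwoFour σ)).mul (isRatQExp_E₄TwoFour σ)

/-- `σ` fixes the Laurent `q`-series of a form of level `4` with `σ`-fixed `q`-expansion. [folklore] -/
theorem mapLaurent_qExpansionL_four_eq {k : ℤ} {F : ModularForm (Gamma0 4) k}
    (hF : IsRatQExp σ ⇑F) : mapLaurent σ (qExpansionL 4 F) = qExpansionL 4 F := by
  rw [qExpansionL_def, mapLaurent_coe_powerSeries, hF.map_eq]

/-- **`σ` fixes the `q`-series of `j(2τ) − 1728 ∈ K_4`.** [folklore] -/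
theorem mapLaurent_kleinJSubFn :
    mapLaurent σ ((kleinJSubFn : modularFunctionField 4) : LaurentSeries ℂ) = kleinJSubFn := by
  change mapLaurent σ (qExpansionL 4 kleinJSubNum / qExpansionL 4 deltaTwoFour) =
    qExpansionL 4 kleinJSubNum / qExpansionL 4 deltaTwoFour
  have hN : qExpansionL 4 kleinJSubNum =
      qExpansionL 4 E₄TwoFourCube - (1728 : ℂ) • qExpansionL 4 deltaTwoFour := by
    rw [kleinJSubNum, sub_eq_add_neg, qExpansionL_add, qExpansionL_neg, qExpansionL_smul,
      ← sub_eq_add_neg]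
  rw [map_div₀, hN, map_sub, ← HahnSeries.C_mul_eq_smul, map_mul,
    mapLaurent_qExpansionL_four_eq σ (isRatQExp_E₄TwoFourCube σ),
    mapLaurent_qExpansionL_four_eq σ (isRatQExp_deltaTwoFour σ)]
  congr 2
  rw [← algebraMap_laurentSeries_apply, mapLaurent_algebraMap, map_ofNat]

/-- The transform of the `q`-series of `γ₃(2τ)` by `σ` is `± γ₃(2τ)`. [folklore] -/
theorem mapLaurent_weberFourFn_eq_or :
    mapLaurent σ ((weberFourFn : modularFunctionField 4) : LaurentSeries ℂ) = weberFourFn ∨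
      mapLaurent σ ((weberFourFn : modularFunctionField 4) : LaurentSeries ℂ) = -weberFourFn := by
  set u : LaurentSeries ℂ := ((weberFourFn : modularFunctionField 4) : LaurentSeries ℂ) with hu
  have hsq : (mapLaurent σ u) ^ 2 = u ^ 2 := by
    have h2 : u ^ 2 = ((kleinJSubFn : modularFunctionField 4) : LaurentSeries ℂ) := by
      rw [hu, ← SubmonoidClass.coe_pow, weberFourFn_sq]
    rw [← map_pow, h2, mapLaurent_kleinJSubFn]
  exact sq_eq_sq_iff_eq_or_eq_neg.mp hsq

/-- **`γ₃(2τ) ∈ ℚ(X₀(4))`: the `q`-series of `γ₃(2τ) ∈ K_4` is fixed by every ring endomorphism of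
`ℂ`.**  The sign in `σ(γ₃(2τ)) = ±γ₃(2τ)` is `+`: apply `σ` to `γ₃(2τ)·Δ(2τ) = E₆(2τ)η(2τ)¹²`,
whose first `q`-coefficient is `1`. [cite: Cox2013, §12.B (`γ₃` and its `q`-expansion)] -/
theorem mapLaurent_weberFourFn :
    mapLaurent σ ((weberFourFn : modularFunctionField 4) : LaurentSeries ℂ) = weberFourFn := by
  rcases mapLaurent_weberFourFn_eq_or σ with h | h
  · exact h
  · exfalso
    set u : LaurentSeries ℂ := ((weberFourFn : modularFunctionField 4) : LaurentSeries ℂ) with hu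
    have hrepr : u * qExpansionL 4 deltaTwoFour = qExpansionL 4 weberFourNum := mkFn_mul _ _ _
    have h1 : -(qExpansionL 4 weberFourNum) = mapLaurent σ (qExpansionL 4 weberFourNum) := by
      have h' := congrArg (mapLaurent σ) hrepr
      rw [map_mul, h, mapLaurent_qExpansionL_four_eq σ (isRatQExp_deltaTwoFour σ)] at h'
      rw [← h', ← hrepr]
      ring
    have h2 : -(qExpansion 1 ⇑weberFourNum) = (qExpansion 1 ⇑weberFourNum).map σ := by
      apply HahnSeries.ofPowerSeries_injective (Γ := ℤ) (R := ℂ)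
      rw [map_neg, ← mapLaurent_coe_powerSeries]
      exact h1
    have h3 := congrArg (PowerSeries.coeff 1) h2
    rw [map_neg, PowerSeries.coeff_map, qExpansion_weberFourNum_coeff_one, map_one] at h3
    norm_num at h3

end Literature.NumberTheory.EllipticCurves.ModularForms

end
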